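/-
Copyright (c) 2026 the pub-hodgecm-mathlib formalisation cell (harness21).  Prover seat hodgecm-mathlib-LH4-p04 (g0), req620 Track A «(D-RAM) FOUR-FRAME» squad
(unit U3_Laws, stub `stub_U3_stableModelSum` (MS), ROAD A step (3); LH4-p11 (g0) (MS seat) TARGET I «DUALITY IS T(E)-EQUIVARIANT FOR DIAGONAL FORMS», signature of
2026-09-03 22:45:05Z verbatim; dealer LH4-plan (g10) WORD #41∕#42).  2026-09-03.
-/
import Literature.NumberTheory.Automorphic.UnitaryLatticeTreeApartment   -- ★ `mem_mapGL_iff`, `dualLatt_mapGL` (the unitary case, template); brings ★ `UnitaryLatticeTreeDual` (`pairing_mulVec_left∕_right`, `mem_dualLatt`)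
import HarnessLib

/-!
# Crux `H413`, line LH4 «(D-RAM) FOUR-FRAME» road — unit U3_Laws (iii), ROAD A (MS) TIER 2 SUPPORT: DUALITY IS EQUIVARIANT FOR THE FULL DIAGONAL TORUS
# (`(z·M)^♯ = σ̃(z)⁻¹·M^♯` for a diagonal form)

Cell `hodgecm-mathlib` (D-0151), FLOOR 0, crux item H413 = `stmt-HodgeConjecture-24833`, route of record `HCCMUnconditional`; squad F0∕P3c∕LH4 (req618∕req620).  THEOREMS ONLY
(no `def`, no instance, no notation, no `sorry`, default heartbeats); lane `--supports stmt-HodgeConjecture-24833 --as helper` (count-neutral).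

WHAT IS PROVED (generic `N`, any field `K` with `Valued K ℤᵐ⁰`, any `σ : K →+* K`).  For a DIAGONAL hermitian form `diag(D)` and a diagonal change of lattice `Z = diag(z)`
(`z_i ≠ 0`, NOT necessarily unitary), the dual lattice transforms by the σ-TWISTED INVERSE: with `Zs = diag(σ(z_i)⁻¹)`,
  `(Z·M)^♯ = Zs·M^♯`      (`^♯` = ★ `dualLatt σ (diag D)`, `·` = ★ `mapGL`).
Because diagonal matrices commute, `⟨Z x, y⟩_{diag D} = Σ σ(z_i x_i) D_i y_i = ⟨x, diag(σ z)·y⟩_{diag D}` (§1 `pairing_diagonal_mulVec_diagonal_left`), so `y ∈ (Z·M)^♯ ⟺ diag(σz)·y ∈ M^♯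
⟺ y ∈ diag(σz)⁻¹·M^♯ = Zs·M^♯` (★ `mem_dualLatt`, ★ `mem_mapGL_iff`, `Zs⁻¹ = diag(σ z)`).  MEANING (LH4-p11 (g0), MEMO-stableLaw-finite §2 (3)): the torus `T(E) = {diag z}` acts on
pairs `(D, M)` by `z·(D, M) = (D∕N(z), z·M)`; this is the equivariance behind the orbit count (3c-iii) of the (S-fin) road and behind «dualisable is 𝒢-invariant».  The tree's ★
`dualLatt_mapGL` is the UNITARY case (`σ̃(u)⁻¹ = u`), ★ `dualLatt_scaleLattice` the scalar case; this file is the full diagonal torus.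
* §1 `coe_inv_eq_diagonal_map_of_coe_eq` (`Zs⁻¹ = diag(σ z)`), `pairing_diagonal_mulVec_diagonal_left` (`⟨diag(z)x, y⟩ = ⟨x, diag(σz)y⟩` for `H = diag D`);
* §2 **`dualLatt_diagonal_mapGL_diagonal`** — TARGET I token for token.
HONEST LABEL.  Count-neutral; nothing printed is asserted; the census laws (MS) stay PROVER TARGETS; `HC_CM` is proved only modulo the 7 printed citations (2 remaining named inputs:
hLiu418 = `stmt-HodgeConjecture-24832`, h413 = `stmt-HodgeConjecture-24833`) until rung 0 closes.

## References
* [Jacobowitz1962] R. Jacobowitz, *Hermitian forms over local fields*, Amer. J. Math. 84 (1962) 441–465, §4 (dual lattices and change of basis).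
* [BruhatTits1972] F. Bruhat, J. Tits, *Groupes réductifs sur un corps local I*, Publ. Math. IHÉS 41 (1972), §10 (the torus action on the building).
* [Serre1980Trees] J.-P. Serre, *Trees*, Springer (1980), Ch. II §1.1 (lattices and the action of diagonal elements).
-/

set_option autoImplicit false

noncomputable section

namespace Summit.HodgeConjecture.HodgeConjecture.Cruxes.H413.F0P3cDyRamDiagonalDualTranslate

open Matrix
open Literature.NumberTheory.Automorphic Literature.NumberTheory.Automorphic.HermitianLattice Literature.NumberTheory.Automorphic.UnitaryGroup
open Literature.NumberTheory.Automorphic.UnitaryLatticeTree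
open scoped Valued WithZero Matrix MatrixGroups

variable {K : Type*} [Field K] [Valued K ℤᵐ⁰] {N : ℕ}

/-! ## §1  The σ-twisted inverse of a diagonal change of lattice, and the adjunction `⟨diag(z)x, y⟩ = ⟨x, diag(σz)y⟩` -/

omit [Valued K ℤᵐ⁰] in
/-- If `(Zs : M_N) = diag(σ(z_i)⁻¹)` with `z_i ≠ 0` then `Zs⁻¹ = diag(σ(z_i))` in `GL_N`. [cite: Serre1980Trees, II §1.1] -/
theorem coe_inv_eq_diagonal_map_of_coe_eq (σ : K →+* K) (z : Fin N → K) (hz : ∀ i, z i ≠ 0) (Zs : GL (Fin N) K)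
    (hZs : (Zs : Matrix (Fin N) (Fin N) K) = Matrix.diagonal fun i => (σ (z i))⁻¹) :
    ((Zs⁻¹ : GL (Fin N) K) : Matrix (Fin N) (Fin N) K) = Matrix.diagonal fun i => σ (z i) :=
  Units.inv_eq_of_mul_eq_one_right (by
    rw [hZs, Matrix.diagonal_mul_diagonal, ← Matrix.diagonal_one]
    congr 1; funext i; exact inv_mul_cancel₀ ((map_ne_zero σ).2 (hz i)))

omit [Valued K ℤᵐ⁰] in
/-- **Adjunction for diagonal forms**: `⟨diag(z)·x, y⟩_{diag D} = ⟨x, diag(σ z)·y⟩_{diag D}` — `Σ σ(z_i x_i) D_i y_i` either way, diagonal matrices commute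
(★ `pairing_mulVec_left`, ★ `pairing_mulVec_right`). [cite: Jacobowitz1962, §4] -/
theorem pairing_diagonal_mulVec_diagonal_left (σ : K →+* K) (D z : Fin N → K) (x y : Fin N → K) :
    pairing σ (Matrix.diagonal D) ((Matrix.diagonal z).mulVec x) y = pairing σ (Matrix.diagonal D) x ((Matrix.diagonal fun i => σ (z i)).mulVec y) := by
  rw [pairing_mulVec_left, pairing_mulVec_right, Matrix.diagonal_map (map_zero σ), Matrix.diagonal_transpose, Matrix.diagonal_mul_diagonal,
    Matrix.diagonal_mul_diagonal]
  have h : (Matrix.diagonal fun i => σ (z i) * D i) = Matrix.diagonal fun i => D i * σ (z i) := by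
    congr 1; funext i; exact mul_comm _ _
  rw [h]

/-! ## §2  The head -/

/-- **HEAD — DUALITY IS `T(E)`-EQUIVARIANT FOR DIAGONAL FORMS** (LH4-p11 (g0) TARGET I): for a diagonal form `diag(D)`, a diagonal `Z = diag(z)` with `z_i ≠ 0` and
`Zs = diag(σ(z_i)⁻¹)`: `(Z·M)^♯ = Zs·M^♯` for every `𝒪`-submodule `M ≤ K^N` — `y ∈ (Z·M)^♯ ⟺ ∀ x ∈ M, |⟨Z x, y⟩| ≤ 1 ⟺ ∀ x ∈ M, |⟨x, diag(σz) y⟩| ≤ 1 ⟺ diag(σz)·y = Zs⁻¹·y ∈ M^♯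
⟺ y ∈ Zs·M^♯` (§1 + ★ `mem_dualLatt` + ★ `mem_mapGL_iff`).  MEMO §2 (3): `z·(D, M) = (D∕N(z), z·M)`. [cite: Jacobowitz1962, §4] [cite: BruhatTits1972, §10] [cite: Serre1980Trees, II §1.1] -/
theorem dualLatt_diagonal_mapGL_diagonal {K : Type*} [Field K] [Valued K ℤᵐ⁰] {N : ℕ} (σ : K →+* K) (D z : Fin N → K) (hz : ∀ i, z i ≠ 0)
    (Z Zs : GL (Fin N) K) (hZ : (Z : Matrix (Fin N) (Fin N) K) = Matrix.diagonal z) (hZs : (Zs : Matrix (Fin N) (Fin N) K) = Matrix.diagonal fun i => (σ (z i))⁻¹)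
    (M : Submodule 𝒪[K] (Fin N → K)) :
    dualLatt σ (Matrix.diagonal D) (mapGL Z M) = mapGL Zs (dualLatt σ (Matrix.diagonal D) M) := by
  have hW := coe_inv_eq_diagonal_map_of_coe_eq σ z hz Zs hZs
  ext y
  rw [mem_dualLatt, mem_mapGL_iff, mem_dualLatt, hW]
  constructor
  · -- `y ∈ (Z·M)^♯ ⇒ diag(σz)·y ∈ M^♯`
    intro h x hx
    rw [← pairing_diagonal_mulVec_diagonal_left]
    refine h _ ?_
    rw [mapGL, hZ]
    exact Submodule.mem_map.2 ⟨x, hx, rfl⟩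
  · -- `diag(σz)·y ∈ M^♯ ⇒ y ∈ (Z·M)^♯`
    intro h x' hx'
    rw [mapGL, hZ] at hx'
    obtain ⟨x, hx, rfl⟩ := Submodule.mem_map.1 hx'
    rw [LinearMap.restrictScalars_apply, Matrix.toLin'_apply, pairing_diagonal_mulVec_diagonal_left]
    exact h x hx

end Summit.HodgeConjecture.HodgeConjecture.Cruxes.H413.F0P3cDyRamDiagonalDualTranslate

end
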